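import Summits.NavierStokesRegularity.NavierStokesRegularity.Theorems.EfficiencyFloorMaximiserSetRigidityOrbitAdmissible
import Literature.Analysis.FluidPDE.NSBoundedClassicalSobolevClass
import Literature.Analysis.FluidPDE.ClassicalSolutionRescale
import Literature.Analysis.FluidPDE.IsometryInvariance
import Literature.Analysis.FluidPDE.TaoLocalisationHolds
import Literature.Analysis.FluidPDE.TaoLocalisationProofs
import HarnessLib

/-!
# Route `EfficiencyFloor`, support `RigidExit` (stmt-NavierStokesRegularity-25513) on the `ProductionEfficiencyDecay` ladder
# (stmt-NavierStokesRegularity-22866): SYMMETRY TRANSPORT OF A ROUTE-CLASS FLOW TO A TAO-CLASS SLAB SOLUTION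

Helper file (`--supports stmt-NavierStokesRegularity-22866`; line `efficiency_floor`). Census item (2) of hand g25 for the
residue (R-shadow) of `ReferenceShadowing.rigidExit_of_referenceShadowing` (p839834): the perturbed flow of (R-shadow) is a flow
of the ROUTE CLASS (maximal classical Leray–Hopf solution at `ν = 1` from a rapidly decaying datum) observed from a time
`s ∈ (0,T)` near an ORBIT POINT `x ↦ l₀ • R₀ (m (l₀ • R₀⁻¹ (x − a₀)))` of a maximiser `m`, while the shadowing estimate
(`ReferenceShadowing.shadow_window`, p840284) wants a classical solution on a closed slab `[0, τ₂]` in the `L²`-Sobolev class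
(Tao's class) near `m` itself at time `0`. This file supplies the transport along the Navier–Stokes symmetry group:

* `isClassicalNSSolutionOn_orbit` — classical solutions of the unforced system are covariant under
  `u ↦ ((t, x) ↦ l • R (u (t₀ + l² t) (l • R⁻¹ (x − a))))` (same viscosity), on any time set of unique differentiability
  mapped into the original one (tree: `IsClassicalNSSolutionOn.nsRescale_translate_zero` + `conj_linearIsometryEquiv`);
* `transport` — **the class-to-slab transport**: for a classical solution `(u,p)` on `[0,T)` at `ν = 1`, Leray–Hopf from its
  rapidly decaying datum, `0 < s`, `0 < L`, `s + L < T`, and any `(a, R, l)` with `l > 0`, the transported flow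
  `ũ (t, x) = l • R (u (s + l² t) (l • R⁻¹ (x − a)))` is, with SOME pressure, a classical solution on the closed slab
  `[0, L/l²]` with all `L²` Sobolev norms of `ũ`, `∂ₜũ` and the pressure bounded (Tao 2013 Cor. 11.1 for the Sobolev bounds
  of `u` on `[0, s+L]`, the Sobolev imbedding `H² ⊂ L^∞`, Leray's energy bound, and the tree's
  `IsClassicalNSSolutionOn.exists_isTaoSolutionOn_translate_of_bounded` applied to the transported flow from time `0`,
  translated by `s/l²`).

HONEST FRAMING: symmetry bookkeeping for classical solutions; (R-shadow), `RigidExit`, `NearMaximiserBoundedAmplification`,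
`LerayFloorGap`, `ProductionEfficiencyDecay` (stmt-22866) and Navier–Stokes regularity stay OPEN; no summit statement is
proved. [folklore]
-/

-- the problem directory repeats the summit name (`NavierStokesRegularity/NavierStokesRegularity`)
set_option linter.dupNamespace false

noncomputable section

open Set Filter MeasureTheory Topology Function
open scoped InnerProductSpace RealInnerProductSpace ENNReal NNReal ContDiff
open Literature.Analysis.FluidPDE

namespace Summit.NavierStokesRegularity.NavierStokesRegularity.Theorems

namespace RigidExit

namespace ReferenceShadowing

/-! ## §1 Classical solutions under the orbit maps -/

/-- **Orbit covariance of classical solutions (unforced).** If `(u,p)` is a classical solution of the unforced system with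
viscosity `ν` on a time set `S`, then for `l > 0`, a linear isometry `R`, `a ∈ ℝ³`, `t₀ ∈ ℝ` and any time set `S'` of unique
differentiability with `t₀ + l² S' ⊆ S`, the pair `(t,x) ↦ l • R (u (t₀ + l² t) (l • R⁻¹ (x − a)))`,
`(t,x) ↦ l² · p (t₀ + l² t) (l • R⁻¹ (x − a))` is a classical solution of the unforced system with the same viscosity on `S'`
(Leray's similarity + rotation + translation). [cite: Leray1934, §20] -/
theorem isClassicalNSSolutionOn_orbit {S S' : Set ℝ} {ν : ℝ}
    {u : ℝ → EuclideanSpace ℝ (Fin 3) → EuclideanSpace ℝ (Fin 3)} {p : ℝ → EuclideanSpace ℝ (Fin 3) → ℝ}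
    (h : IsClassicalNSSolutionOn S ν 0 u p) (a : EuclideanSpace ℝ (Fin 3))
    (R : EuclideanSpace ℝ (Fin 3) ≃ₗᵢ[ℝ] EuclideanSpace ℝ (Fin 3)) {l : ℝ} (hl : 0 < l) (t₀ : ℝ)
    (hS' : ∀ r ∈ S', t₀ + l ^ 2 * r ∈ S) (hU : UniqueDiffOn ℝ S') :
    IsClassicalNSSolutionOn S' ν 0
      (fun t x => l • R (u (t₀ + l ^ 2 * t) (l • R.symm (x - a))))
      (fun t x => l ^ 2 * p (t₀ + l ^ 2 * t) (l • R.symm (x - a))) := by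
  -- Leray scaling + space translation by `x₀ = -(l • R⁻¹ a)`, on the full preimage, then restriction to `S'`
  have key₀ := h.nsRescale_translate_zero hl t₀ (-(l • R.symm a))
  have hsub : S' ⊆ (fun r => t₀ + l ^ 2 * r) ⁻¹' S := fun r hr => hS' r hr
  have key₁ := key₀.mono hsub hU
  -- conjugation by the isometry `R`
  have key₂ := key₁.conj_linearIsometryEquiv R hU
  have hf : (fun t x => R ((0 : ℝ → EuclideanSpace ℝ (Fin 3) → EuclideanSpace ℝ (Fin 3)) t (R.symm x))) = 0 := by
    funext t x; simp
  have hu : (fun t x => R ((l • stPull (l ^ 2) l t₀ (-(l • R.symm a)) u) t (R.symm x))) =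
      fun t x => l • R (u (t₀ + l ^ 2 * t) (l • R.symm (x - a))) := by
    funext t x
    simp only [Pi.smul_apply, stPull_apply, LinearIsometryEquiv.map_smul, map_sub, smul_sub]
    congr 2
    abel
  have hp : (fun t x => (l ^ 2 • stPull (l ^ 2) l t₀ (-(l • R.symm a)) p) t (R.symm x)) =
      fun t x => l ^ 2 * p (t₀ + l ^ 2 * t) (l • R.symm (x - a)) := by
    funext t x
    simp only [Pi.smul_apply, stPull_apply, map_sub, smul_sub, smul_eq_mul]
    congr 2
    abel
  rw [hf, hu, hp] at key₂
  exact key₂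

/-! ## §2 The class-to-slab transport -/

/-- **Class-to-slab transport along the symmetry group.** Let `(u,p)` be a classical solution of the unforced system at
`ν = 1` on `[0,T) × ℝ³`, Leray–Hopf from its rapidly decaying datum `u 0`, and let `0 < s`, `0 < L`, `s + L < T`. For every
`a ∈ ℝ³`, linear isometry `R` and `l > 0`, the transported flow `ũ (t,x) = l • R (u (s + l² t) (l • R⁻¹ (x − a)))` is, together
with some pressure `q`, a classical solution on the closed slab `[0, L/l²]` with all `L²` Sobolev norms of `ũ`, of
`∂ₜũ` (one-sided within `[0, L/l²]`) and of `q` bounded. [cite: Tao2013Localisation, Cor. 11.1] -/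
theorem transport {T : ℝ} {u : ℝ → EuclideanSpace ℝ (Fin 3) → EuclideanSpace ℝ (Fin 3)}
    {p : ℝ → EuclideanSpace ℝ (Fin 3) → ℝ} (hcl : IsClassicalNSSolutionOn (Ico 0 T) 1 0 u p)
    (hLH : IsLerayHopfOn T 1 0 (u 0) u) (hdec : HasRapidSpatialDecay (u 0))
    {s L : ℝ} (hs : 0 < s) (hL : 0 < L) (hsL : s + L < T)
    (a : EuclideanSpace ℝ (Fin 3)) (R : EuclideanSpace ℝ (Fin 3) ≃ₗᵢ[ℝ] EuclideanSpace ℝ (Fin 3)) {l : ℝ} (hl : 0 < l) :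
    ∃ q : ℝ → EuclideanSpace ℝ (Fin 3) → ℝ,
      IsClassicalNSSolutionOn (Icc 0 (L / l ^ 2)) 1 0 (fun t x => l • R (u (s + l ^ 2 * t) (l • R.symm (x - a)))) q ∧
      HasBoundedSobolevNormsOn (Icc 0 (L / l ^ 2)) (fun t x => l • R (u (s + l ^ 2 * t) (l • R.symm (x - a)))) ∧
      HasBoundedSobolevNormsOn (Icc 0 (L / l ^ 2))
        (timeDerivWithin (Icc 0 (L / l ^ 2)) (fun t x => l • R (u (s + l ^ 2 * t) (l • R.symm (x - a))))) ∧
      (∀ n : ℕ, ∃ C : ℝ≥0, ∀ t ∈ Icc 0 (L / l ^ 2), ∫⁻ x, ‖iteratedFDeriv ℝ n (q t) x‖ₑ ^ 2 ≤ C) := by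
  have hl2 : 0 < l ^ 2 := by positivity
  have hT' : 0 < s + L := by linarith
  -- the closed slab `[0, s + L]`: classical, finite energy, Sobolev bounds, bounded velocity
  have hcl' : IsClassicalNSSolutionOn (Icc 0 (s + L)) 1 0 u p :=
    hcl.mono (Icc_subset_Ico_right hsL) (uniqueDiffOn_Icc hT')
  have hE : ∀ t ∈ Icc 0 (s + L), ∫⁻ x, ‖u t x‖ₑ ^ 2 ≤ ENNReal.ofReal (2 * VectorCalculus.kineticEnergy (u 0)) :=
    fun t ht => hLH.lintegral_enorm_sq_le zero_le_one ⟨ht.1, ht.2.trans hsL.le⟩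
  have hE' : ∃ C : ℝ≥0, ∀ t ∈ Icc 0 (s + L), ∫⁻ x, ‖u t x‖ₑ ^ 2 ≤ C :=
    ⟨(2 * VectorCalculus.kineticEnergy (u 0)).toNNReal, fun t ht => hE t ht⟩
  have hB : HasBoundedSobolevNormsOn (Icc 0 (s + L)) u :=
    tao2011_hasBoundedSobolevNormsOn_holds one_pos hT' hcl' hE' hdec
  obtain ⟨M, hM⟩ := linfty_bound_of_hasBoundedSobolevNormsOn_holds
    (fun t ht => (hcl'.contDiff_velocity ht).of_le (by norm_cast)) hB
  -- the transported flow from time `0`, on `[0, (s+L)/l²]`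
  set U : ℝ → EuclideanSpace ℝ (Fin 3) → EuclideanSpace ℝ (Fin 3) :=
    fun t x => l • R (u (0 + l ^ 2 * t) (l • R.symm (x - a))) with hUdef
  set P : ℝ → EuclideanSpace ℝ (Fin 3) → ℝ := fun t x => l ^ 2 * p (0 + l ^ 2 * t) (l • R.symm (x - a)) with hPdef
  have hTs : 0 < (s + L) / l ^ 2 := by positivity
  have hmap : ∀ r ∈ Icc 0 ((s + L) / l ^ 2), 0 + l ^ 2 * r ∈ Icc 0 (s + L) := by
    intro r hr
    refine ⟨by nlinarith [hr.1], ?_⟩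
    have := hr.2
    rw [le_div_iff₀ hl2] at this
    linarith
  have hUcl : IsClassicalNSSolutionOn (Icc 0 ((s + L) / l ^ 2)) 1 0 U P :=
    isClassicalNSSolutionOn_orbit hcl' a R hl 0 hmap (uniqueDiffOn_Icc hTs)
  -- bounded velocity and finite energy of the transported flow
  have hUM : ∀ t ∈ Icc 0 ((s + L) / l ^ 2), ∀ x, ‖U t x‖ ≤ l * M := by
    intro t ht x
    simp only [hUdef, norm_smul, LinearIsometryEquiv.norm_map, Real.norm_eq_abs, abs_of_pos hl]
    exact mul_le_mul_of_nonneg_left (hM _ (hmap t ht) _) hl.le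
  have hUE : ∃ A : ℝ≥0∞, A < ⊤ ∧ ∀ t ∈ Icc 0 ((s + L) / l ^ 2), ∫⁻ x, ‖U t x‖ₑ ^ 2 ≤ A := by
    refine ⟨ENNReal.ofReal (l ^ 2) * (ENNReal.ofReal ((l ^ 3)⁻¹) * ENNReal.ofReal (2 * VectorCalculus.kineticEnergy (u 0))),
      ENNReal.mul_lt_top ENNReal.ofReal_lt_top (ENNReal.mul_lt_top ENNReal.ofReal_lt_top ENNReal.ofReal_lt_top),
      fun t ht => ?_⟩
    have hpt : ∀ x, ‖U t x‖ₑ ^ 2 = ENNReal.ofReal (l ^ 2) * ‖u (0 + l ^ 2 * t) (l • R.symm (x - a))‖ₑ ^ 2 := by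
      intro x
      simp only [hUdef]
      rw [enorm_smul, LinearIsometryEquiv.enorm_map, mul_pow, Real.enorm_eq_ofReal hl.le, ← ENNReal.ofReal_pow hl.le]
    calc ∫⁻ x, ‖U t x‖ₑ ^ 2 = ∫⁻ x, ENNReal.ofReal (l ^ 2) * ‖u (0 + l ^ 2 * t) (l • R.symm (x - a))‖ₑ ^ 2 :=
          lintegral_congr fun x => hpt x
      _ = ENNReal.ofReal (l ^ 2) * ∫⁻ x, ‖u (0 + l ^ 2 * t) (l • R.symm (x - a))‖ₑ ^ 2 :=
          lintegral_const_mul' _ _ ENNReal.ofReal_ne_top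
      _ = ENNReal.ofReal (l ^ 2) * (ENNReal.ofReal ((l ^ 3)⁻¹) * ∫⁻ x, ‖u (0 + l ^ 2 * t) x‖ₑ ^ 2) := by
          rw [MaximiserSetRigidity.OrbitInvariance.lintegral_comp_orbitMap (fun y => ‖u (0 + l ^ 2 * t) y‖ₑ ^ 2) a R hl]
      _ ≤ ENNReal.ofReal (l ^ 2) * (ENNReal.ofReal ((l ^ 3)⁻¹) * ENNReal.ofReal (2 * VectorCalculus.kineticEnergy (u 0))) := by
          gcongr
          exact hE _ (hmap t ht)
  -- Tao's class for the translate by `δ = s/l²`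
  have hδ : 0 < s / l ^ 2 := by positivity
  have hδT : s / l ^ 2 < (s + L) / l ^ 2 := div_lt_div_of_pos_right (by linarith) hl2
  obtain ⟨q, hq⟩ := hUcl.exists_isTaoSolutionOn_translate_of_bounded hTs hUE hUM hδ hδT
  -- identification of the translate with `ũ` and of the slab length with `L/l²`
  have hlen : (s + L) / l ^ 2 - s / l ^ 2 = L / l ^ 2 := by
    field_simp
    ring
  have hfun : (fun t => U (t + s / l ^ 2)) = fun t x => l • R (u (s + l ^ 2 * t) (l • R.symm (x - a))) := by
    funext t x
    simp only [hUdef]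
    have ht : 0 + l ^ 2 * (t + s / l ^ 2) = s + l ^ 2 * t := by
      field_simp
      ring
    rw [ht]
  rw [hlen, hfun] at hq
  exact ⟨q, hq.classical, hq.sobolev, hq.sobolev_dt, hq.sobolev_p⟩

end ReferenceShadowing

end RigidExit

end Summit.NavierStokesRegularity.NavierStokesRegularity.Theorems

end
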